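import Literature.NumberTheory.EllipticCurves.TateModuleFree
import HarnessLib

/-!
# Monogenic Tate modules: `T_p A = ℤ_p · v₀` when `#A[p] ≤ p`

Pure `ℤ_p`-module algebra on the Tate module `T_p A = lim← A[pⁿ]` of an abelian group `A`
(tree `Literature.NumberTheory.EllipticCurves.TateModule`), complementing `TateModuleFree.lean`
(`div`, `p_smul_div`, `ker (T_p A → A[p]) = p T_p A`, `p`-adic separatedness) and
`TateModuleRank.lean` (rank `d` from EXACT counts `#A[pⁿ] = p^{dn}`): here only the UPPER BOUND
`#A[p] ≤ p` is assumed, and the conclusion is that `T_p A` is generated by ONE element.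

* `exists_proj_one_eq_nsmul` — if every finite set of `p`-torsion elements of `A` has at most `p`
  members and `(v₀)_1 ≠ 0`, then every first component `τ_1` is a multiple `k • (v₀)_1`.
* `exists_eq_smul_of_card_torsionBy_le` — ★ then every `τ ∈ T_p A` is `c • v₀`, `c ∈ ℤ_p`
  (Nakayama for the `p`-adically complete `ℤ_p` and the separated `T_p A`, Mathlib
  `surjective_of_mkQ_comp_surjective`, exactly as in `finite_of_finite_torsionBy`).
* `exists_proj_one_ne_zero_of_ne_zero` — a non-zero Tate module has an element with `(v₀)_1 ≠ 0`.
* `exists_generator_of_card_torsionBy_le` — ★ packaged: `#A[p] ≤ p`, `T_p A ≠ 0` ⇒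
  `∃ v₀ ≠ 0, T_p A = ℤ_p v₀`.
* `exists_character_of_generator` — a group acting on `A` acts on a monogenic `T_p A` through a
  nowhere-vanishing function `ρ : G → ℤ_p`, `σ • v₀ = ρ σ • v₀`.

Used for the Tate module of a HEIGHT-ONE formal group (`#Ŵ[p](𝔪_ℂ) ≤ p` by Weierstrass preparation),
see `Literature.NumberTheory.PAdicHodge.FormalTateModuleRankOne`.

References: Silverman, *AEC* III.§7 (Prop. III.7.1) and IV.§7; Serre, *Abelian ℓ-adic representations* I.1.1.
-/

noncomputable section

open scoped Classical
open scoped AddSubgroup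

namespace Literature.NumberTheory.EllipticCurves.TateModule

variable {A : Type*} [AddCommGroup A] {p : ℕ} [Fact p.Prime]

/-- If every finite set of `p`-torsion elements of `A` has at most `p` members and `v₀ ∈ T_p A` has
non-zero first component `(v₀)_1 ∈ A[p]`, then the first component of every `τ ∈ T_p A` is a multiple
`k • (v₀)_1` (the `p` multiples `k • (v₀)_1`, `k < p`, are distinct and exhaust the `p`-torsion).
[cite: SilvermanAEC2009, Prop. III.7.1 (proof)] -/
theorem exists_proj_one_eq_nsmul (hcard : ∀ s : Finset A, (∀ x ∈ s, p • x = 0) → s.card ≤ p)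
    {v₀ : TateModule A p} (hv₀ : proj p 1 v₀ ≠ 0) (τ : TateModule A p) :
    ∃ k : ℕ, proj p 1 τ = k • proj p 1 v₀ := by
  have hp : p.Prime := Fact.out
  set w := proj p 1 v₀ with hw
  have hpw : p • w = 0 := by have h := pow_smul_proj 1 v₀; rwa [pow_one] at h
  have hord : addOrderOf w = p := addOrderOf_eq_prime hpw hv₀
  have hinj : Set.InjOn (fun k : ℕ => k • w) (Finset.range p : Set ℕ) := by
    intro a ha b hb hab
    have h := nsmul_injOn_Iio_addOrderOf (x := w)
    rw [hord] at h
    exact h (Set.mem_Iio.2 (Finset.mem_range.1 (Finset.mem_coe.1 ha)))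
      (Set.mem_Iio.2 (Finset.mem_range.1 (Finset.mem_coe.1 hb))) hab
  by_contra hne
  push Not at hne
  have hmem : proj p 1 τ ∉ (Finset.range p).image (fun k : ℕ => k • w) := by
    intro h
    obtain ⟨k, -, hk⟩ := Finset.mem_image.1 h
    exact hne k hk.symm
  have hcard_s : (insert (proj p 1 τ) ((Finset.range p).image fun k : ℕ => k • w)).card = p + 1 := by
    rw [Finset.card_insert_of_notMem hmem, Finset.card_image_of_injOn hinj, Finset.card_range]
  have htors : ∀ x ∈ insert (proj p 1 τ) ((Finset.range p).image fun k : ℕ => k • w), p • x = 0 := by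
    intro x hx
    rcases Finset.mem_insert.1 hx with rfl | hx
    · have h := pow_smul_proj 1 τ; rwa [pow_one] at h
    · obtain ⟨k, -, rfl⟩ := Finset.mem_image.1 hx
      rw [smul_smul, mul_comm, ← smul_smul, hpw, smul_zero]
  have := hcard _ htors
  omega

/-- ★ **Monogenicity.** If every finite set of `p`-torsion elements of `A` has at most `p` members and
`(v₀)_1 ≠ 0`, then `T_p A = ℤ_p · v₀`: every `τ` is `c • v₀`. (Nakayama for the `p`-adically complete
`ℤ_p` and the `p`-adically separated `T_p A`: `c ↦ c • v₀` is onto modulo `p T_p A = ker (T_p A → A[p])`.)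
[cite: SilvermanAEC2009, Prop. III.7.1 (proof)] [cite: Serre1968, I.1.1] -/
theorem exists_eq_smul_of_card_torsionBy_le
    (hcard : ∀ s : Finset A, (∀ x ∈ s, p • x = 0) → s.card ≤ p)
    {v₀ : TateModule A p} (hv₀ : proj p 1 v₀ ≠ 0) (τ : TateModule A p) :
    ∃ c : ℤ_[p], τ = c • v₀ := by
  let f : ℤ_[p] →ₗ[ℤ_[p]] TateModule A p := LinearMap.toSpanSingleton ℤ_[p] (TateModule A p) v₀
  have hf : Function.Surjective
      ((IsLocalRing.maximalIdeal ℤ_[p] • ⊤ : Submodule ℤ_[p] (TateModule A p)).mkQ ∘ₗ f) := by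
    intro q
    obtain ⟨b, rfl⟩ := Submodule.mkQ_surjective _ q
    obtain ⟨k, hk⟩ := exists_proj_one_eq_nsmul hcard hv₀ b
    refine ⟨(k : ℤ_[p]), ?_⟩
    simp only [LinearMap.coe_comp, Function.comp_apply, f, LinearMap.toSpanSingleton_apply,
      Submodule.mkQ_apply]
    rw [Submodule.Quotient.eq]
    refine mem_maximalIdeal_smul_top_of_proj_one_eq_zero ?_
    rw [map_sub, proj_natCast_smul, hk, sub_self]
  obtain ⟨c, hc⟩ := surjective_of_mkQ_comp_surjective hf τ
  exact ⟨c, hc.symm⟩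

omit [Fact p.Prime] in
/-- A non-zero Tate module has an element with non-zero FIRST component (if all first components
vanished, dividing by `p` repeatedly would kill every component). [cite: SilvermanAEC2009, III.§7] -/
theorem exists_proj_one_ne_zero_of_ne_zero {τ : TateModule A p} (hτ : τ ≠ 0) :
    ∃ v₀ : TateModule A p, proj p 1 v₀ ≠ 0 := by
  by_contra h
  push Not at h
  apply hτ
  suffices hall : ∀ (n : ℕ) (σ : TateModule A p), proj p n σ = 0 from
    TateModule.ext fun n => by rw [hall, map_zero]
  intro n
  induction n with
  | zero => intro σ; simpa using pow_smul_proj 0 σ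
  | succ n ih => intro σ; rw [← proj_div σ (h σ)]; exact ih _

/-- ★ **A non-zero Tate module with `#A[p] ≤ p` is free of rank one**: `∃ v₀ ≠ 0` with `T_p A = ℤ_p · v₀`.
[cite: SilvermanAEC2009, Prop. III.7.1 (proof)] [cite: Serre1968, I.1.1] -/
theorem exists_generator_of_card_torsionBy_le
    (hcard : ∀ s : Finset A, (∀ x ∈ s, p • x = 0) → s.card ≤ p) (hT : ∃ τ : TateModule A p, τ ≠ 0) :
    ∃ v₀ : TateModule A p, v₀ ≠ 0 ∧ ∀ τ : TateModule A p, ∃ c : ℤ_[p], τ = c • v₀ := by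
  obtain ⟨τ, hτ⟩ := hT
  obtain ⟨v₀, hv₀⟩ := exists_proj_one_ne_zero_of_ne_zero hτ
  exact ⟨v₀, fun h0 => hv₀ (by rw [h0, map_zero]), exists_eq_smul_of_card_torsionBy_le hcard hv₀⟩

/-- **The character of a monogenic Tate module.** If a group `G` acts on `A` (hence on `T_p A`) and
`T_p A = ℤ_p · v₀` with `v₀ ≠ 0`, then `σ • v₀ = ρ σ • v₀` for a nowhere-vanishing `ρ : G → ℤ_p`.
[cite: Serre1968, I.1.1] -/
theorem exists_character_of_generator {G : Type*} [Group G] [DistribMulAction G A]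
    {v₀ : TateModule A p} (hv₀ : v₀ ≠ 0) (hgen : ∀ τ : TateModule A p, ∃ c : ℤ_[p], τ = c • v₀) :
    ∃ ρ : G → ℤ_[p], ∀ σ : G, σ • v₀ = ρ σ • v₀ ∧ ρ σ ≠ 0 := by
  choose ρ hρ using fun σ : G => hgen (σ • v₀)
  refine ⟨ρ, fun σ => ⟨hρ σ, fun h0 => ?_⟩⟩
  have h1 : σ • v₀ = 0 := by rw [hρ σ, h0, zero_smul]
  have h2 := congrArg (fun x : TateModule A p => σ⁻¹ • x) h1
  simp only [inv_smul_smul, smul_zero] at h2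
  exact hv₀ h2

end Literature.NumberTheory.EllipticCurves.TateModule
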